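import Mathlib
import HarnessLib

/-!
# The jackknife bias correction of `dF = −log(pooled mean)` is second order: an explicit bound

HONEST FRAMING: exact (Metropolis-corrected) sampling algorithms for lattice gauge theory;
figures of merit are autocorrelation/cost numbers at stated couplings and volumes; no
continuum-physics claim.

Venture `LatticeQCDFlow` (cell pub-lqcd), topic `Exactness`; FANOUT row 13 (`eng-snf`, GEN-25).
NEW WORK of the cell (elementary real analysis), Mathlib only; not a published result; no
definition; nothing cited as a fact (Quenouille / Tukey NAMED ONLY).  Quantitative companion of
GEN-25 `NCMCGeneralSpaceReplicaJackknifeBiasSign` (`neg_log_pooledMean_biasCorrected_le`: the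
correction LOWERS `dF`, i.e. `0 ≤ dF − dF_biascorr`); this file bounds the size of the correction
from above by block-level quantities.

WHY (row 13).  `estimators.jackknife` prints, for the free-energy estimate of `R ≥ 2` blocks with
positive block values `y_r` (block means of `e^{−(W − max)}`), `dF = −log ȳ` (`ȳ = (1/R)Σ_r y_r`)
and the Quenouille–Tukey corrected value `dF_biascorr = R·dF − (R−1)·(1/R)Σ_r dF_{(−r)}`,
`dF_{(−r)} = −log ȳ_{(−r)}`, `ȳ_{(−r)} = (Σ_{s≠r} y_s)/(R−1)`.  From `1 − 1/x ≤ log x`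
(`Real.one_sub_inv_le_log_of_pos`) at `x = b/a`:
`0 ≤ −log b + log a + (b − a)/a ≤ (b − a)²/(a·b)` for `a, b > 0`; summing at `a = ȳ`,
`b = ȳ_{(−r)}` — where the first-order terms CANCEL because `Σ_r ȳ_{(−r)} = R·ȳ` — and using
`ȳ_{(−r)} − ȳ = (ȳ − y_r)/(R−1)`:

  **`dF − dF_biascorr ≤ (1/(R(R−1))) · Σ_r (y_r − ȳ)² / (ȳ · ȳ_{(−r)})`**
  (`neg_log_jackknife_biasCorrection_le`), hence, if every leave-one-out mean is `≥ m > 0`,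
  **`dF − dF_biascorr ≤ (ȳ/m) · s²_Δ`** with `s²_Δ = (Σ_r (y_r − ȳ)²/(R(R−1)))/ȳ²` the
  linearised (delta-method) squared standard error of `log ȳ`
  (`neg_log_jackknife_biasCorrection_le_ratio_mul`).

So the printed correction is of the order of the SQUARED error bar — `o(n^{−1/2})` next to the
`n^{−1/2}` half-width — whenever no single block dominates the pooled mean (`ȳ/m` moderate); a
large `dF − dF_biascorr` relative to `dF_err²` is itself a block-dominance signal.

* `neg_log_add_log_add_div_nonneg` / **`neg_log_add_log_add_div_le`** — the pointwise sandwich;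
* **`neg_log_jackknife_biasCorrection_le`**, `…_le_of_le_looMean`, `…_le_ratio_mul`.

NOT CLAIMED: the sign (companion file); anything stochastic (coverage is GEN-25
`…ReplicaJackknifeDeltaMethod`); anything numerical.
-/

namespace Summit.Ventures.LatticeQCDFlow.Exactness.GeneralNCMC

open Finset

/-! ## §1 The pointwise sandwich `0 ≤ −log b + log a + (b − a)/a ≤ (b − a)²/(ab)` -/

section Pointwise

/-- First order (convexity of `−log`): `0 ≤ −log b + log a + (b − a)/a` for `a, b > 0`. -/
theorem neg_log_add_log_add_div_nonneg {a b : ℝ} (ha : 0 < a) (hb : 0 < b) :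
    0 ≤ -Real.log b + Real.log a + (b - a) / a := by
  have h := Real.log_le_sub_one_of_pos (div_pos hb ha)
  rw [Real.log_div hb.ne' ha.ne'] at h
  have hba : b / a - 1 = (b - a) / a := by field_simp
  linarith

/-- **Second order**: `−log b + log a + (b − a)/a ≤ (b − a)²/(a·b)` for `a, b > 0`
(from `1 − a/b ≤ log(b/a)`). -/
theorem neg_log_add_log_add_div_le {a b : ℝ} (ha : 0 < a) (hb : 0 < b) :
    -Real.log b + Real.log a + (b - a) / a ≤ (b - a) ^ 2 / (a * b) := by
  have h := Real.one_sub_inv_le_log_of_pos (div_pos hb ha)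
  rw [Real.log_div hb.ne' ha.ne', inv_div] at h
  have hab : 1 - a / b = -((a - b) / b) := by field_simp; ring
  calc -Real.log b + Real.log a + (b - a) / a
      ≤ (a - b) / b + (b - a) / a := by linarith
    _ = (b - a) ^ 2 / (a * b) := by field_simp; ring

end Pointwise

/-! ## §2 The bound on `dF − dF_biascorr` -/

section Jackknife

variable {ι : Type*} [Fintype ι] [DecidableEq ι]

/-- **`dF − dF_biascorr ≤ (1/(R(R−1))) Σ_r (y_r − ȳ)²/(ȳ·ȳ_{(−r)})`** for `R ≥ 2` blocks with
positive block values (`ȳ`, `ȳ_{(−r)}` passed as `ybar`, `loo` with their defining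
equations). -/
theorem neg_log_jackknife_biasCorrection_le (hR : 2 ≤ Fintype.card ι) {y : ι → ℝ}
    (hy : ∀ r, 0 < y r) {ybar : ℝ} {loo : ι → ℝ} (hbar : ybar = (∑ r, y r) / Fintype.card ι)
    (hloo : ∀ r, loo r = (∑ s ∈ univ.erase r, y s) / ((Fintype.card ι : ℝ) - 1)) :
    -Real.log ybar
          - ((Fintype.card ι : ℝ) * (-Real.log ybar)
              - ((Fintype.card ι : ℝ) - 1) * ((∑ r, -Real.log (loo r)) / Fintype.card ι))
      ≤ (∑ r, (y r - ybar) ^ 2 / (ybar * loo r))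
          / ((Fintype.card ι : ℝ) * ((Fintype.card ι : ℝ) - 1)) := by
  have hRpos : 0 < Fintype.card ι := by omega
  haveI : Nonempty ι := Fintype.card_pos_iff.mp hRpos
  have hR0 : (0 : ℝ) < Fintype.card ι := by exact_mod_cast hRpos
  have hR1 : (0 : ℝ) < (Fintype.card ι : ℝ) - 1 := by
    have : (2 : ℝ) ≤ Fintype.card ι := by exact_mod_cast hR
    linarith
  have hybar : 0 < ybar := by
    rw [hbar]; exact div_pos (sum_pos (fun r _ => hy r) univ_nonempty) hR0
  have hne : ∀ r : ι, ((univ : Finset ι).erase r).Nonempty := fun r => by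
    rw [← Finset.card_pos, card_erase_of_mem (mem_univ r), card_univ]; omega
  have hloo_pos : ∀ r, 0 < loo r := fun r => by
    rw [hloo r]; exact div_pos (sum_pos (fun s _ => hy s) (hne r)) hR1
  -- `ȳ_{(−r)} − ȳ = (ȳ − y_r)/(R−1)`
  have hdiff : ∀ r, loo r - ybar = (ybar - y r) / ((Fintype.card ι : ℝ) - 1) := fun r => by
    rw [hloo r, sum_erase_eq_sub (mem_univ r), hbar]
    field_simp
    ring
  -- the first-order terms cancel: `Σ_r (ȳ_{(−r)} − ȳ)/ȳ = 0`
  have hsum0 : ∑ r, (loo r - ybar) / ybar = 0 := by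
    simp_rw [hdiff]
    rw [← sum_div, ← sum_div, sum_sub_distrib, sum_const, card_univ, nsmul_eq_mul, hbar,
      mul_div_cancel₀ _ hR0.ne', sub_self, zero_div, zero_div]
  -- sum the pointwise second-order bounds
  have hS := sum_le_sum fun r (_ : r ∈ univ) =>
    neg_log_add_log_add_div_le (a := ybar) (b := loo r) hybar (hloo_pos r)
  rw [sum_add_distrib, sum_add_distrib, hsum0, add_zero, sum_const, card_univ,
    nsmul_eq_mul] at hS
  -- `(y_r − ȳ)² = (R−1)² (ȳ_{(−r)} − ȳ)²`
  have hyr : ∀ r, (y r - ybar) ^ 2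
      = ((Fintype.card ι : ℝ) - 1) ^ 2 * (loo r - ybar) ^ 2 := fun r => by
    rw [hdiff r]
    field_simp
    ring
  simp_rw [hyr]
  have hsum : ∑ r, ((Fintype.card ι : ℝ) - 1) ^ 2 * (loo r - ybar) ^ 2 / (ybar * loo r)
      = ((Fintype.card ι : ℝ) - 1) ^ 2 * ∑ r, (loo r - ybar) ^ 2 / (ybar * loo r) := by
    rw [mul_sum]
    exact sum_congr rfl fun r _ => by ring
  have key : -Real.log ybar
        - ((Fintype.card ι : ℝ) * (-Real.log ybar)
            - ((Fintype.card ι : ℝ) - 1) * ((∑ r, -Real.log (loo r)) / Fintype.card ι))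
      = ((Fintype.card ι : ℝ) - 1) / Fintype.card ι
          * (∑ r, -Real.log (loo r) + (Fintype.card ι : ℝ) * Real.log ybar) := by
    field_simp
    ring
  have key' : ((Fintype.card ι : ℝ) - 1) ^ 2 * (∑ r, (loo r - ybar) ^ 2 / (ybar * loo r))
        / ((Fintype.card ι : ℝ) * ((Fintype.card ι : ℝ) - 1))
      = ((Fintype.card ι : ℝ) - 1) / Fintype.card ι
          * ∑ r, (loo r - ybar) ^ 2 / (ybar * loo r) := by
    rw [div_mul_eq_mul_div, div_eq_div_iff (mul_pos hR0 hR1).ne' hR0.ne']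
    ring
  rw [hsum, key, key']
  exact mul_le_mul_of_nonneg_left hS (by positivity)

/-- **With a floor on the leave-one-out means**: if every `ȳ_{(−r)} ≥ m > 0` then
`dF − dF_biascorr ≤ Σ_r (y_r − ȳ)² / (R(R−1)·ȳ·m)`. -/
theorem neg_log_jackknife_biasCorrection_le_of_le_looMean (hR : 2 ≤ Fintype.card ι) {y : ι → ℝ}
    (hy : ∀ r, 0 < y r) {ybar : ℝ} {loo : ι → ℝ} (hbar : ybar = (∑ r, y r) / Fintype.card ι)
    (hloo : ∀ r, loo r = (∑ s ∈ univ.erase r, y s) / ((Fintype.card ι : ℝ) - 1))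
    {m : ℝ} (hm : 0 < m) (hmle : ∀ r, m ≤ loo r) :
    -Real.log ybar
          - ((Fintype.card ι : ℝ) * (-Real.log ybar)
              - ((Fintype.card ι : ℝ) - 1) * ((∑ r, -Real.log (loo r)) / Fintype.card ι))
      ≤ (∑ r, (y r - ybar) ^ 2)
          / ((Fintype.card ι : ℝ) * ((Fintype.card ι : ℝ) - 1) * (ybar * m)) := by
  have hRpos : 0 < Fintype.card ι := by omega
  haveI : Nonempty ι := Fintype.card_pos_iff.mp hRpos
  have hR0 : (0 : ℝ) < Fintype.card ι := by exact_mod_cast hRpos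
  have hR1 : (0 : ℝ) < (Fintype.card ι : ℝ) - 1 := by
    have : (2 : ℝ) ≤ Fintype.card ι := by exact_mod_cast hR
    linarith
  have hybar : 0 < ybar := by
    rw [hbar]; exact div_pos (sum_pos (fun r _ => hy r) univ_nonempty) hR0
  have h1 : ∑ r, (y r - ybar) ^ 2 / (ybar * loo r) ≤ ∑ r, (y r - ybar) ^ 2 / (ybar * m) :=
    sum_le_sum fun r _ => div_le_div_of_nonneg_left (sq_nonneg _) (by positivity)
      (mul_le_mul_of_nonneg_left (hmle r) hybar.le)
  calc _ ≤ _ := neg_log_jackknife_biasCorrection_le hR hy hbar hloo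
    _ ≤ (∑ r, (y r - ybar) ^ 2 / (ybar * m))
          / ((Fintype.card ι : ℝ) * ((Fintype.card ι : ℝ) - 1)) :=
        div_le_div_of_nonneg_right h1 (by positivity)
    _ = (∑ r, (y r - ybar) ^ 2)
          / ((Fintype.card ι : ℝ) * ((Fintype.card ι : ℝ) - 1) * (ybar * m)) := by
        rw [← sum_div, div_div, mul_comm (ybar * m)]

/-- **`dF − dF_biascorr ≤ (ȳ/m) · s²_Δ`**, `s²_Δ = (Σ_r (y_r − ȳ)²/(R(R−1)))/ȳ²` the linearised
squared standard error of `log ȳ`: the correction is of the order of the SQUARED error bar times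
the block-dominance ratio `ȳ/m`. -/
theorem neg_log_jackknife_biasCorrection_le_ratio_mul (hR : 2 ≤ Fintype.card ι) {y : ι → ℝ}
    (hy : ∀ r, 0 < y r) {ybar : ℝ} {loo : ι → ℝ} (hbar : ybar = (∑ r, y r) / Fintype.card ι)
    (hloo : ∀ r, loo r = (∑ s ∈ univ.erase r, y s) / ((Fintype.card ι : ℝ) - 1))
    {m : ℝ} (hm : 0 < m) (hmle : ∀ r, m ≤ loo r) :
    -Real.log ybar
          - ((Fintype.card ι : ℝ) * (-Real.log ybar)
              - ((Fintype.card ι : ℝ) - 1) * ((∑ r, -Real.log (loo r)) / Fintype.card ι))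
      ≤ ybar / m
          * ((∑ r, (y r - ybar) ^ 2) / ((Fintype.card ι : ℝ) * ((Fintype.card ι : ℝ) - 1))
              / ybar ^ 2) := by
  have hRpos : 0 < Fintype.card ι := by omega
  haveI : Nonempty ι := Fintype.card_pos_iff.mp hRpos
  have hR0 : (0 : ℝ) < Fintype.card ι := by exact_mod_cast hRpos
  have hR1 : (0 : ℝ) < (Fintype.card ι : ℝ) - 1 := by
    have : (2 : ℝ) ≤ Fintype.card ι := by exact_mod_cast hR
    linarith
  have hybar : 0 < ybar := by
    rw [hbar]; exact div_pos (sum_pos (fun r _ => hy r) univ_nonempty) hR0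
  refine (neg_log_jackknife_biasCorrection_le_of_le_looMean hR hy hbar hloo hm hmle).trans
    (le_of_eq ?_)
  field_simp

end Jackknife

end Summit.Ventures.LatticeQCDFlow.Exactness.GeneralNCMC
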